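import Mathlib
import HarnessLib
import Summits.HubbardSuperconductivity.HubbardSuperconductivity.Theorems.KLProgrammeKLRegimeEngineScaleZeroE4PackageDoors
import Summits.HubbardSuperconductivity.HubbardSuperconductivity.Theorems.KLProgrammeKLRegimeEngineV8DefsU10

/-!
# K3 ENGINE (stmt-HubbardSuperconductivity-20437 `KLRegimeEngineV17F2`), stub (b) / (ℓ) #20: the FRAME WEIGHT of the flow frame IN THE REGIME —
# `Σ_z ‖Ǩ_{K}(z)‖·(1 + |z|) ≤ klE4KapF R·U + 2·(c/log 4)·klE4Mom R` for every admissible frame (cell gate-hubbard-kl, seat p1b g17 — 20437 registrant lineage;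
# located item «(ℓ)-FRAME-WEIGHT-SHAPE», KL STATUS 2026-08-29)

WHY.  The (ℓ) levels-clause assembly (`…TowerLevAssemblyKlEngFinal`, p696349) reads the weighted vertex profile whose degree-1 entry is
`(|β|/4M)·Σ_z ‖framePosKernel L K_n z‖(1 + torusSiteDist z 0)`, and the numerics package (`…TowerLevNumericsPackage`, p696519) asks the frame weight in the
shape `F ≤ f₀·U`.  `FrameOK R U (nScales β) μ K` does NOT give that shape: its jets bound the first position moment of each of the `n_β + 1` frame pieces by an
`n`-UNIFORM `U²`-term, so the total carries `(n_β + 1)·U²`, which is `β`-uniform only through the regime `(n_β + 1)·U² ≤ c/log 4` — a `c`-term.  Everything needed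
is ALREADY landed (scale-0 (E4) precedent): `frameKernel_weightedL1_le` (…ScaleZeroE4PackageParts §2), `nScales_succ_mul_sq_le` and `kKbar_le` (…ScaleZeroE4PackageDoors §1).
This file is the 3-lemma glue, stated ON STUB (b)'s OWN BINDERS, so the #20 frame-weight input is discharged with NO E1 data:

* `frameWeight_le_of_frameOK_regime` — `R.WF`, `0 < U ≤ 1`, `0 ≤ c`, `klBetaMin ≤ β ≤ exp(c/U²)`, `FrameOK R U (nScales β) μ K` ⇒
  `Σ_z ‖framePosKernel L K z‖(1 + torusSiteDist z 0) ≤ klE4KapF R·U + 2·(c/log 4)·klE4Mom R`;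
* `frameWeight_klFlowFrameU_le` — the instance at the flow frame `K_n` under the registered door `U ≤ klEngU₀10 P R c` (any `G`/U-token above it, e.g.
  `klEngU₀12G8 G P R c ≤ klEngU₀10 P R c`), `U ≤ 1` read from `klEngU₀10 ≤ klEngU₀3` (`le_one_of_le_klEngU₀3`).
The θ-smallness then wants a U-door AND a c-door (`thetaW_smallness_of_doors`: `U ≤ klE4U₀ R`, `c ≤ klE4C₃ R`, both on the registered chains via
`klEngU₀10_le_klEngU₀6`/`klEngU₀6_le_klE4U₀`, `klEngC₃6_le_klE4C₃`), not `U ≤ 1/(2θ₁+1)` alone.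
Pure composition of landed lemmas; nothing about the model is asserted beyond them; nothing asserts (b), (ℓ), any stub of 20437, K3 or superconductivity.
References: BGM 2006 §2.1 (2.5)–(2.6a), §2.7 (2.77)–(2.80) [cite: BenfattoGiulianiMastropietro2006].
-/

noncomputable section

namespace Summit.HubbardSuperconductivity.HubbardSuperconductivity.Theorems.EngineV8

set_option linter.dupNamespace false -- summit = problem name (single-conjunct summit), D-0017

open Real Finset Literature.MathematicalPhysics.QuantumLattice Literature.Probability.LatticeModels
open Summit.HubbardSuperconductivity.HubbardSuperconductivity.Theorems.KLRegimeSplit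
open Summit.HubbardSuperconductivity.HubbardSuperconductivity.Theorems.DispersionFlow

variable {L : ℕ} [NeZero L]

/-- **The frame weight in the regime**: for an admissible frame `K` (`FrameOK R U (nScales β) μ K`), `R.WF`, `0 < U ≤ 1`, `0 ≤ c` and
`klBetaMin ≤ β ≤ exp(c/U²)`: `Σ_z ‖Ǩ_L(z)‖·(1 + |z|_∞) ≤ klE4KapF R·U + 2·(c/log 4)·klE4Mom R` — a `U`-term plus a `c`-term (the `(n_β+1)·U²` first-moment
budget of the `n_β + 1` frame pieces, converted by `(n_β+1)·U² ≤ c/log 4`). [cite: BenfattoGiulianiMastropietro2006, §2.7 (2.80)] -/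
theorem frameWeight_le_of_frameOK_regime {R : RenConsts} (hR : R.WF) {U c β μ : ℝ} (hU : 0 < U) (hU1 : U ≤ 1) (hc : 0 ≤ c)
    (hβ : klBetaMin ≤ β) (hβc : β ≤ Real.exp (c / U ^ 2)) {K : TrigPolyC4v} (hK : FrameOK R U (nScales β) μ K) :
    ∑ z : TorusSite 2 L, ‖framePosKernel L K z‖ * (1 + torusSiteDist z 0) ≤ klE4KapF R * U + 2 * (c / Real.log 4) * klE4Mom R := by
  have hUabs : |U| = U := abs_of_pos hU
  have hU1' : |U| ≤ 1 := by rw [hUabs]; exact hU1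
  have h := (frameKernel_weightedL1_le (L := L) hR hU.ne' hU1' hK).trans (kKbar_le hR (nScales_succ_mul_sq_le hc hβ hβc))
  rw [hUabs] at h
  exact h

/-- **The frame weight of the FLOW FRAME `K_n` under stub (b)'s binders** (`hfr : FrameOK R U (nScales β) μ (klFlowFrameU L M β U μ n)`, the U-door read at
`klEngU₀10 P R c` — every registered U-token lies below it — and the regime). [cite: BenfattoGiulianiMastropietro2006, §2.7 (2.80)] -/
theorem frameWeight_klFlowFrameU_le {M : ℕ} [NeZero M] {P : SplitConsts} {R : RenConsts} (hR : R.WF2) {c μ U β : ℝ} (hc : 0 < c)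
    (hU : 0 < U) (hU10 : U ≤ klEngU₀10 P R c) (hβ : klBetaMin ≤ β) (hβc : β ≤ Real.exp (c / U ^ 2)) {n : ℕ}
    (hfr : FrameOK R U (nScales β) μ (klFlowFrameU L M β U μ n)) :
    ∑ z : TorusSite 2 L, ‖framePosKernel L (klFlowFrameU L M β U μ n) z‖ * (1 + torusSiteDist z 0) ≤
      klE4KapF R * U + 2 * (c / Real.log 4) * klE4Mom R :=
  frameWeight_le_of_frameOK_regime hR.wf hU (le_one_of_le_klEngU₀3 (hU10.trans (klEngU₀10_le_klEngU₀3 P R c))) hc.le hβ hβc hfr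

end Summit.HubbardSuperconductivity.HubbardSuperconductivity.Theorems.EngineV8

end
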